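import Summits.RiemannHypothesis.RiemannHypothesis.Theses.WeilComb
import Literature.NumberTheory.LFunctions.RosserSchoenfeldMertensFirstProofs
import Literature.NumberTheory.LFunctions.SchoenfeldPsiSmall
import Literature.NumberTheory.LFunctions.ChebyshevSylvesterPsi
import Mathlib.NumberTheory.Chebyshev
import Mathlib.NumberTheory.ArithmeticFunction.VonMangoldt
import Mathlib.Data.Nat.Factorization.Basic
import Mathlib.Analysis.Complex.ExponentialBounds

/-!
# The Helson potential with the elementary constant `3/20`
(crux `WeilComb.CombShapePositivity`, item stmt-RiemannHypothesis-11229, line `Sketch`, towards `stub_windowCore`)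

For the band residual `stub_windowCore` of Theorem B the budget of the effective window is governed by the
constant `G` in the Helson-potential bound `Σ_m ‖a_m‖²(log m + ψ₁(M/m)) ≤ (log M + G)‖a‖²`,
`ψ₁(y) = Σ_{n ≤ y} Λ(n)/n`. The landed `stub_helsonG` has `G = 39/50` (Rosser–Schoenfeld (3.24) plus
`Σ_p (log p)/(p(p−1)) ≤ 0.7724`). Here we prove the sharper, entirely elementary

`ψ₁(N) ≤ log N + 3/20` for every `N ≥ 1`  (`sum_vonMangoldt_div_le_log_add_three_twentieths`),

hence `G = 3/20` (`helsonPotential_le_three_twentieths`). Proof: Legendre's identity in von Mangoldt form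
`Σ_{n ≤ N} Λ(n)⌊N/n⌋ = log N!` (exact: `log k = Σ_{d ∣ k} Λ(d)`), `⌊N/n⌋ ≥ (N+1)/n − 1`, so
`(N+1)ψ₁(N) ≤ log N! + ψ(N)`; Stirling `log N! ≤ N log N − N + (log N)/2 + 1`
(`RosserSchoenfeld324.log_factorial_le`) and the tree's explicit Chebyshev bounds `ψ(N) ≤ 1.04 N`
(`N ≤ 10⁴`, `SchoenfeldBound.psi_le_of_le_ten_thousand`) and `ψ(N) ≤ 1.0722 N + 7√N ≤ 1.1422 N` (`N ≥ 10⁴`,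
`psi_le_sylvester`) give `(N+1)(ψ₁(N) − log N − 3/20) ≤ (a − 1 − 3/20)N + 17/20 − (log N)/2 ≤ 0` for `N ≥ 3`
(`a = 1.04`, resp. `1.1422`); `N = 1, 2` directly. (True value: `sup_{N ≥ 1}(ψ₁(N) − log N) = 0`, attained at
`N = 1`; `ψ₁(N) − log N → −γ`.)
-/

noncomputable section

-- the sub-problem path `RiemannHypothesis/RiemannHypothesis` (single-conjunct summit, D-0017) duplicates a namespace
set_option linter.dupNamespace false

open scoped BigOperators

namespace Summit.RiemannHypothesis.RiemannHypothesis.Theorems.WeilCombBohrFejer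

open Literature.NumberTheory.LFunctions

/-- **Legendre's identity in von Mangoldt form**: `Σ_{n ≤ N} Λ(n) ⌊N/n⌋ = log N!`
(`log N! = Σ_{k ≤ N} log k`, `log k = Σ_{d ∣ k} Λ(d)`, and `d` has `⌊N/d⌋` multiples in `[1, N]`). [folklore] -/
theorem sum_vonMangoldt_mul_div_eq_log_factorial (N : ℕ) :
    ∑ n ∈ Finset.Icc 1 N, (ArithmeticFunction.vonMangoldt n : ℝ) * ((N / n : ℕ) : ℝ) =
      Real.log (N.factorial : ℝ) := by
  have hIcc : Finset.Icc 1 N = Finset.Ioc 0 N := by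
    ext n
    simp only [Finset.mem_Icc, Finset.mem_Ioc]
    omega
  have h1 : (N.factorial : ℝ) = ∏ i ∈ Finset.range N, ((i : ℝ) + 1) := by
    rw [← Finset.prod_range_add_one_eq_factorial]
    push_cast
    rfl
  have h2 : Real.log (N.factorial : ℝ) = ∑ k ∈ Finset.Icc 1 N, Real.log (k : ℝ) := by
    rw [h1, Real.log_prod]
    · rw [← Finset.Ico_add_one_right_eq_Icc, Finset.sum_Ico_eq_sum_range]
      simp only [Nat.add_sub_cancel, Nat.cast_add, Nat.cast_one]
      exact Finset.sum_congr rfl fun i _ => by rw [add_comm]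
    · intro i _
      positivity
  have h3 : ∑ k ∈ Finset.Icc 1 N, Real.log (k : ℝ) =
      ∑ k ∈ Finset.Icc 1 N, ∑ d ∈ k.divisors, (ArithmeticFunction.vonMangoldt d : ℝ) :=
    Finset.sum_congr rfl fun k _ => ArithmeticFunction.vonMangoldt_sum.symm
  rw [h2, h3, Finset.sum_comm' (s' := fun d => (Finset.Icc 1 N).filter (d ∣ ·)) (t' := Finset.Icc 1 N)]
  · refine Finset.sum_congr rfl fun d _ => ?_
    rw [Finset.sum_const, nsmul_eq_mul, hIcc, Nat.Ioc_filter_dvd_card_eq_div N d, mul_comm]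
  · intro k d
    simp only [Finset.mem_Icc, Nat.mem_divisors, Finset.mem_filter]
    constructor
    · rintro ⟨⟨hk1, hkN⟩, hdk, hk0⟩
      have hdpos : 0 < d := Nat.pos_of_dvd_of_pos hdk (by omega)
      have hdk' : d ≤ k := Nat.le_of_dvd (by omega) hdk
      exact ⟨⟨⟨hk1, hkN⟩, hdk⟩, hdpos, hdk'.trans hkN⟩
    · rintro ⟨⟨⟨hk1, hkN⟩, hdk⟩, -, -⟩
      exact ⟨⟨hk1, hkN⟩, hdk, by omega⟩

/-- `(N + 1) ψ₁(N) ≤ log N! + ψ(N)`: Legendre's identity with `⌊N/n⌋ ≥ (N+1)/n − 1`. [folklore] -/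
theorem succ_mul_sum_vonMangoldt_div_le (N : ℕ) :
    ((N : ℝ) + 1) * ∑ n ∈ Finset.Icc 1 N, (ArithmeticFunction.vonMangoldt n : ℝ) / n ≤
      Real.log (N.factorial : ℝ) + ∑ n ∈ Finset.Icc 1 N, (ArithmeticFunction.vonMangoldt n : ℝ) := by
  rw [← sum_vonMangoldt_mul_div_eq_log_factorial N, Finset.mul_sum, ← sub_le_iff_le_add,
    ← Finset.sum_sub_distrib]
  refine Finset.sum_le_sum fun n hn => ?_
  have hn1 : 0 < n := (Finset.mem_Icc.1 hn).1
  have hfl := RosserSchoenfeld324.sub_one_le_natDiv N n hn1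
  have hΛ : 0 ≤ (ArithmeticFunction.vonMangoldt n : ℝ) := ArithmeticFunction.vonMangoldt_nonneg
  have hn0 : (0 : ℝ) < n := by exact_mod_cast hn1
  have e : ((N : ℝ) + 1) * ((ArithmeticFunction.vonMangoldt n : ℝ) / n) -
      (ArithmeticFunction.vonMangoldt n : ℝ) =
      (ArithmeticFunction.vonMangoldt n : ℝ) * (((N : ℝ) + 1) / n - 1) := by
    field_simp
  rw [e]
  exact mul_le_mul_of_nonneg_left hfl hΛ

/-- The Chebyshev function at naturals as the `Icc`-sum: `ψ(K) = Σ_{1 ≤ n ≤ K} Λ(n)`. [folklore] -/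
private theorem psi_natCast_eq_sum_Icc (K : ℕ) :
    Chebyshev.psi (K : ℝ) = ∑ n ∈ Finset.Icc 1 K, (ArithmeticFunction.vonMangoldt n : ℝ) := by
  have e : Finset.Icc 1 K = Finset.Ioc 0 K := by
    ext n; simp only [Finset.mem_Icc, Finset.mem_Ioc]; omega
  rw [Chebyshev.psi, Nat.floor_natCast, e]

/-- `ψ(K) ≤ 1.04 K` for `K ≤ 10⁴` (`SchoenfeldBound.psi_le_of_le_ten_thousand`). [cite: RosserSchoenfeld1962, Theorem 12] -/
private theorem sum_Icc_vonMangoldt_le_small {K : ℕ} (hK : (K : ℝ) ≤ 10000) :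
    ∑ n ∈ Finset.Icc 1 K, (ArithmeticFunction.vonMangoldt n : ℝ) ≤ 1.04 * (K : ℝ) := by
  rw [← psi_natCast_eq_sum_Icc]
  exact SchoenfeldBound.psi_le_of_le_ten_thousand (Nat.cast_nonneg K) hK

/-- `ψ(K) ≤ 1.1422 K` for `K ≥ 10⁴` (`psi_le_sylvester`: `ψ(x) ≤ 1.0722 x + 7√x` and `7√K ≤ 0.07 K`). [folklore] -/
private theorem sum_Icc_vonMangoldt_le_large {K : ℕ} (hK : (10000 : ℝ) ≤ K) :
    ∑ n ∈ Finset.Icc 1 K, (ArithmeticFunction.vonMangoldt n : ℝ) ≤ 1.1422 * (K : ℝ) := by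
  rw [← psi_natCast_eq_sum_Icc]
  have hK0 : (0 : ℝ) ≤ K := Nat.cast_nonneg K
  have h := psi_le_sylvester hK0
  have h100 : (100 : ℝ) ≤ Real.sqrt K := by
    rw [Real.le_sqrt (by norm_num) hK0]
    nlinarith
  have hss : Real.sqrt K * Real.sqrt K = K := Real.mul_self_sqrt hK0
  nlinarith [Real.sqrt_nonneg (K : ℝ), mul_nonneg (Real.sqrt_nonneg (K : ℝ)) (sub_nonneg.2 h100)]

/-- `1.0974 ≤ log 3` (`3^12 ≥ 2^19`, `log 2 > 0.6931471803`). [folklore] -/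
private theorem log_three_ge : (1.0974 : ℝ) ≤ Real.log 3 := by
  have h := RosserSchoenfeld324.pow_log_le 2 19 3 12
  have h2 := Real.log_two_gt_d9
  push_cast at h
  linarith

/-- **`ψ₁(N) ≤ log N + 3/20`** for every `N ≥ 1`, `ψ₁(N) = Σ_{n ≤ N} Λ(n)/n` (elementary: Legendre,
Stirling, Chebyshev; see the module docstring). [folklore] -/
theorem sum_vonMangoldt_div_le_log_add_three_twentieths {N : ℕ} (hN : 1 ≤ N) :
    ∑ n ∈ Finset.Icc 1 N, (ArithmeticFunction.vonMangoldt n : ℝ) / n ≤ Real.log N + 3 / 20 := by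
  rcases Nat.lt_or_ge N 3 with hN3 | hN3
  · -- `N = 1` or `N = 2`
    interval_cases N
    · norm_num [ArithmeticFunction.vonMangoldt_apply_one]
    · have e : Finset.Icc 1 2 = {1, 2} := by decide
      rw [e, Finset.sum_insert (by decide), Finset.sum_singleton, ArithmeticFunction.vonMangoldt_apply_one,
        ArithmeticFunction.vonMangoldt_apply_prime Nat.prime_two]
      push_cast
      have h2 := Real.log_two_gt_d9
      linarith
  · -- `N ≥ 3`
    have hN0 : (0 : ℝ) < N := by exact_mod_cast (by omega : 0 < N)
    have hN3r : (3 : ℝ) ≤ N := by exact_mod_cast hN3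
    have hmain := succ_mul_sum_vonMangoldt_div_le N
    have hfact := RosserSchoenfeld324.log_factorial_le N hN
    have hlog3 : (1.0974 : ℝ) ≤ Real.log N :=
      log_three_ge.trans (Real.log_le_log (by norm_num) hN3r)
    set S := ∑ n ∈ Finset.Icc 1 N, (ArithmeticFunction.vonMangoldt n : ℝ) / n with hS
    -- it suffices to bound `(N+1) S`
    suffices h : ((N : ℝ) + 1) * S ≤ ((N : ℝ) + 1) * (Real.log N + 3 / 20) from
      le_of_mul_le_mul_left h (by positivity)
    rcases le_or_gt (N : ℝ) 10000 with hK | hK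
    · have hψ := sum_Icc_vonMangoldt_le_small hK
      nlinarith
    · have hψ := sum_Icc_vonMangoldt_le_large hK.le
      have hlog9 : (2 : ℝ) ≤ Real.log N := by
        have h8 : Real.log 8 = 3 * Real.log 2 := by
          rw [show (8 : ℝ) = 2 ^ 3 by norm_num, Real.log_pow]; push_cast; ring
        have h2 := Real.log_two_gt_d9
        have : Real.log 8 ≤ Real.log N := Real.log_le_log (by norm_num) (by linarith)
        linarith
      nlinarith

/-- Row bound of the Helson potential: for `1 ≤ m ≤ M`, `log m + ψ₁(M/m) ≤ log M + 3/20`. [folklore] -/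
theorem log_add_sum_vonMangoldt_div_le_three_twentieths {M m : ℕ} (hm : m ∈ Finset.Icc 1 M) :
    Real.log m + ∑ n ∈ Finset.Icc 1 (M / m), (ArithmeticFunction.vonMangoldt n : ℝ) / n ≤
      Real.log M + 3 / 20 := by
  have hm1 : 1 ≤ m := (Finset.mem_Icc.1 hm).1
  have hmM : m ≤ M := (Finset.mem_Icc.1 hm).2
  have hm0 : (0 : ℝ) < m := by exact_mod_cast hm1
  have hM0 : (0 : ℝ) < M := by exact_mod_cast (lt_of_lt_of_le hm1 hmM)
  have hq1 : 1 ≤ M / m := (Nat.le_div_iff_mul_le hm1).2 (by simpa using hmM)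
  have hq0 : (0 : ℝ) < ((M / m : ℕ) : ℝ) := by exact_mod_cast hq1
  have key := sum_vonMangoldt_div_le_log_add_three_twentieths hq1
  have hdiv : ((M / m : ℕ) : ℝ) ≤ (M : ℝ) / m := Nat.cast_div_le
  have hlog : Real.log ((M / m : ℕ) : ℝ) ≤ Real.log M - Real.log m := by
    rw [← Real.log_div hM0.ne' hm0.ne']
    exact Real.log_le_log hq0 hdiv
  linarith

/-- **Helson potential, constant `3/20`.** For every `M`, `a`:
`Σ_m ‖a_m‖² (log m + ψ₁(M/m)) ≤ (log M + 3/20) Σ ‖a_m‖²`. [folklore] -/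
theorem helsonPotential_le_three_twentieths : ∀ (M : ℕ) (a : ℕ → ℂ),
    ∑ m ∈ Finset.Icc 1 M, ‖a m‖ ^ 2 *
        (Real.log m + ∑ n ∈ Finset.Icc 1 (M / m), (ArithmeticFunction.vonMangoldt n : ℝ) / n) ≤
      (Real.log M + 3 / 20) * ∑ m ∈ Finset.Icc 1 M, ‖a m‖ ^ 2 := by
  intro M a
  rw [Finset.mul_sum]
  refine Finset.sum_le_sum fun m hm => ?_
  have h := log_add_sum_vonMangoldt_div_le_three_twentieths hm
  have h0 : 0 ≤ ‖a m‖ ^ 2 := by positivity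
  calc ‖a m‖ ^ 2 *
        (Real.log m + ∑ n ∈ Finset.Icc 1 (M / m), (ArithmeticFunction.vonMangoldt n : ℝ) / n)
      ≤ ‖a m‖ ^ 2 * (Real.log M + 3 / 20) := mul_le_mul_of_nonneg_left h h0
    _ = (Real.log M + 3 / 20) * ‖a m‖ ^ 2 := mul_comm _ _

end Summit.RiemannHypothesis.RiemannHypothesis.Theorems.WeilCombBohrFejer

end
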